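import Summits.Langlands.Langlands.Theses.OrdinaryPrimeTransport
import Summits.Langlands.Langlands.Theorems.BaseFieldAscentReciprocityTRCMPotentialAutomorphyCMTightness
import Literature.NumberTheory.Automorphic.BLGGT2014PotentialAutomorphy
import Literature.NumberTheory.Automorphic.PolarizedCompatibleSystemRationalModelsProofs
import Literature.NumberTheory.Automorphic.AlgebraicityTwist
import Literature.NumberTheory.GaloisRepresentations.RestrictFieldSelf
import HarnessLib

/-!
# Line `PotCrystallinePotentialAutomorphyTR` — G4 ladder-down rung (generation 37) on the crux
# `ReciprocityUpToIrreducibility` (item stmt-Langlands-14328; routes IrreducibilityBySelfDuality,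
# OrdinaryPrimeTransport)

TOP `E` = `Summit.Langlands.Langlands.Theses.OrdinaryPrimeTransport.ReciprocityUpToIrreducibility` (the
`Iff.rfl`-equal copy of `…Theses.IrreducibilityBySelfDuality.ReciprocityUpToIrreducibility`, item
stmt-Langlands-14328 shared by both routes; `Langlands ↔ E` landed:
`Theorems.IrreducibleOffSector.langlands_iff_reciprocityUpToIrreducibility_of_JS`).

DIAL (in `E`'s own language, clause (B) Galois → automorphic, every `n`, `F` totally real, the odd essentially
self-dual regular sector): the `p`-ADIC HODGE TYPE CLAUSE at `v ∣ l` in Barnet-Lamb–Gee–Geraghty–Taylor's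
potential automorphy theorem for a single `l`-adic representation — the tree's named fact
`Literature.NumberTheory.Automorphic.BLGGT2014_thmC_potentialAutomorphy` (BLGGT, *Potential automorphy and
change of weight*, Ann. of Math. 179 (2014), Theorem C = Cor. 4.5.2, arXiv:1010.2561), whose hypothesis (3)
is "`r|G_{F_v}` is POTENTIALLY DIAGONALIZABLE (and hence potentially crystalline) for all `v ∣ l`, with `n`
distinct `τ`-Hodge–Tate numbers".
* `θ = 0`: hypothesis (3) verbatim (de Rham for the pinned datum, distinct labels, compatible crystalline
  extension data exist and `r|G_{F_v}` is potentially diagonalizable for every instance) — FLOOR, in the tree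
  (`floor_zero`, binders verbatim, conclusion in the normalisation-free shape below, the fact's `IsSemisimple`
  conjunct dropped).
* `θ = 1`: POTENTIALLY CRYSTALLINE (potentially diagonalizable OR every Weil–Deligne representation the pinned
  Fontaine datum attaches to `r|G_{F_v}` has `N = 0`), every other binder unchanged (`F` totally real,
  `l ≥ 2(n+1)`, `r` irreducible, a.e. unramified, odd essentially self-dual, regular, `r̄|G_{F(ζ_l)}`
  absolutely irreducible) — THE RUNG `PotCrystallinePotentialAutomorphyTR = SelfDualPotentialAutomorphy 1` —
  OPEN.  Located stop, in print: BLGGT p. 4 "Could every crystalline representation be potentially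
  diagonalizable? (We have no reason to believe this, but we know of no counterexample.)", §1.4 p. 14 "It seems
  to us an interesting, and important, question to determine which potentially crystalline representations are
  potentially diagonalizable. As far as we know they could all be."; Calegari–Emerton–Gee (JIMJ 2022,
  arXiv:1807.03529) p. 3 "Conjecturally, every component is expected to be globally realizable … but proving
  this seems to be a very hard problem", p. 8 "beyond the Fontaine–Laffaille and ordinary cases, nothing is known
  about the potential diagonalizability or otherwise of `n`-dimensional representations"; arXiv:2604.17466
  (2026) p. 3 "It is therefore of central importance to determine whether all potentially crystalline
  representations are potentially diagonalizable. … established only in relatively restricted settings"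
  (ordinary / Fontaine–Laffaille: BLGGT Lemma 1.4.3, Gao–Liu 2014; `n = 2` Hodge–Tate `[0,1]`: Gee–Kisin
  Lemma 3.4.1; pseudo-Barsotti–Tate: Bartlett 2023; `n = 3` weights `(2,1,0)`, `p ≥ 5`: ibid. Thm. 1.1).
  The engine stops at the relation `r|G_{F_v} ∼ r₀|G_{F_v}` of BLGGT Thm. 4.2.1 / 4.3.1: Taylor–Wiles–Kisin
  patching sees the support of `M_∞` one irreducible component of the local crystalline lifting ring at a time
  (`Literature.Barriers.Langlands.PatchingLocalComponentBarrier`), and the Harris-tetrahedron witnesses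
  (CM / Dwork motives found by Moret-Bailly) are ordinary or Fontaine–Laffaille, i.e. on the DIAGONAL component.
* `θ ≥ 2`: no type condition beyond de Rham and regularity (potentially semistable, any monodromy) — the cells
  above the rung (`HigherRungs`), constant from `θ = 2` on (`family_add_two_iff`).
CONCLUSION of every cell (normalisation-free, so that the fact — unitary normalisation `m = n`, HLTT — and the
summit — `m = 1`, L-algebraic — both prove it): `∃` a Galois totally real `F'/F`, a level witness, a cuspidal
`π` of `GL_n(𝔸_{F'})`, an `m : ℕ` and an infinity type `T` of `π` with `T.twist ((1-m)/2)` L-algebraic, such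
that at almost all `w`, `π_w` is unramified with Satake parameter `α` and `r|G_{F'}` is unramified at `w` with
`char(Frob_w) = arithFrobPolyOfSatake ι (N w) m α` (`PotentiallyWeaklyAutomorphicTR`).

CEILING-LIFT INPUT, typed (§6): `LocalPotentialDiagonalizability` (every potentially crystalline `r|G_{F_v}` with
distinct labels over the pinned datum is potentially diagonalizable for every instance of compatible crystalline
extension data) with `rung_of_localPD : LocalPotentialDiagonalizability → BLGGT2014_thmC_potentialAutomorphy →
PotCrystallinePotentialAutomorphyTR` PROVED — the purely local form of BLGGT's question; the rung is its
global (potential-automorphy) shadow and may also fall to "globally realizable components"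
(Calegari–Emerton–Gee Thm. 2, `n = 2` or `n` odd) without it.

LINE SHAPE (four registered stubs, composition sorry-free, §9):
`stub_rung : PotCrystallinePotentialAutomorphyTR` (the cap-lifting rung) →
`stub_higherRungs : HigherRungs` (the cells above: potentially semistable, `N ≠ 0`, types) →
`stub_sectorMerge : SectorMergeStep` (`SelfDualPotentialAutomorphy 2 → SectorGaloisToAutomorphic`: potential ⇒
actual automorphy over `F` for every `ι` and every `Rec` — non-solvable descent, cuspidality, local–global
compatibility against the pinned data — honest, itself open in general) →
`stub_offSector : OffSectorReciprocity` (E with clause (A) entire and clause (B) off the sector) →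
`ReciprocityUpToIrreducibility_of … : E` BY NAME.  §5: `E → every cell` and `Langlands → every cell`
(sorry-free; the on-path lemma `PotCrystallinePotentialAutomorphyTR_of_Langlands`, with `F' := F`, `m := 1`).
-/

noncomputable section

set_option linter.dupNamespace false

open scoped MatrixGroups Matrix NumberField Classical
open NumberField IsDedekindDomain Field Filter
open Literature.NumberTheory.Automorphic Literature.NumberTheory.GaloisRepresentations
open Literature.NumberTheory.PAdicHodge
open Summit.Langlands

namespace Summit.Langlands.Langlands.Cruxes.ReciprocityUpToIrreducibility.PotCrystallinePotentialAutomorphyTR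

/-! ## 1. The dial clause (the ONE hypothesis that moves: the `p`-adic Hodge type at `v ∣ l`) -/

/-- The **type clause** of the dial, on two propositions `PD` ("potentially diagonalizable for every
instance of compatible crystalline extension data over the pinned datum, and such an instance exists" —
hypothesis (3) of BLGGT Thm. C verbatim) and `PC` ("potentially crystalline": every Weil–Deligne
representation attached to `r|Γ_{F_v}` by the pinned Fontaine datum has `N = 0`):
`θ = 0` — `PD` (the tree's fact); `θ = 1` — `PD ∨ PC` (potentially crystalline; PD ⇒ potentially
crystalline in print, BLGGT §1.4, the disjunction keeps the cells nested in the tree's abstract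
vocabulary); `θ ≥ 2` — no condition beyond de Rham (potentially semistable, any monodromy). -/
def typeClause : ℕ → Prop → Prop → Prop
  | 0, PD, _ => PD
  | 1, PD, PC => PD ∨ PC
  | _ + 2, _, _ => True

@[simp] theorem typeClause_zero (PD PC : Prop) : typeClause 0 PD PC = PD := rfl
@[simp] theorem typeClause_one (PD PC : Prop) : typeClause 1 PD PC = (PD ∨ PC) := rfl
@[simp] theorem typeClause_add_two (θ : ℕ) (PD PC : Prop) : typeClause (θ + 2) PD PC = True := rfl

/-- The clause only weakens as `θ` grows (nested cells). -/
theorem typeClause_mono {θ θ' : ℕ} (hle : θ ≤ θ') {PD PC : Prop} (h : typeClause θ PD PC) :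
    typeClause θ' PD PC := by
  match θ, θ', hle, h with
  | 0, 0, _, h => exact h
  | 0, 1, _, h => exact Or.inl h
  | 1, 1, _, h => exact h
  | _, _ + 2, _, _ => trivial
  | 1, 0, hle, _ => omega
  | _ + 2, 0, hle, _ => omega
  | _ + 2, 1, hle, _ => omega

/-! ## 2. Hypotheses, conclusion, family, rung -/

/-- **Hypothesis (2) of BLGGT Thm. C, verbatim from the tree's fact** (odd essential self-duality): `r`
maps to `GSp_n` with totally odd multiplier, or to `GO_n` with totally even multiplier. -/
def OddEssSelfDual (F : Type) [Field F] [NumberField F] (l : ℕ) [Fact l.Prime] {n : ℕ}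
    (r : FramedGaloisRep F (PadicAlgCl l) n) : Prop :=
  (∃ (J : Matrix (Fin n) (Fin n) (PadicAlgCl l)) (μ : absoluteGaloisGroup F →* (PadicAlgCl l)ˣ),
      Jᵀ = -J ∧ IsUnit J.det ∧
      (∀ g : absoluteGaloisGroup F, (r g).val.transpose * J * (r g).val = (μ g : PadicAlgCl l) • J) ∧
      ∀ (φ : F →+* ℝ) (c : absoluteGaloisGroup F), IsComplexConjugation φ c → μ c = -1) ∨
    (∃ (J : Matrix (Fin n) (Fin n) (PadicAlgCl l)) (μ : absoluteGaloisGroup F →* (PadicAlgCl l)ˣ),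
      J.IsSymm ∧ IsUnit J.det ∧
      (∀ g : absoluteGaloisGroup F, (r g).val.transpose * J * (r g).val = (μ g : PadicAlgCl l) • J) ∧
      ∀ (φ : F →+* ℝ) (c : absoluteGaloisGroup F), IsComplexConjugation φ c → μ c = 1)

/-- **Local cell `θ` at a place `v ∣ l`** (hypothesis (3) of BLGGT Thm. C with its potential
diagonalizability conjunct DIALLED): for Fontaine's PINNED datum `D = fontainePstAdicCompletion v l hv`,
`r|Γ_{F_v}` is de Rham, has `n` distinct `τ`-labelled Hodge–Tate numbers for every `ℚ_l`-label `τ`, and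
satisfies `typeClause θ PD PC`. At `θ = 0` this is the fact's clause (3) symbol for symbol. -/
def LocalCell (θ : ℕ) (F : Type) [Field F] [NumberField F] (l : ℕ) [Fact l.Prime] {n : ℕ}
    (r : FramedGaloisRep F (PadicAlgCl l) n) (v : HeightOneSpectrum (𝓞 F))
    (hv : ((l : ℕ) : 𝓞 F) ∈ v.asIdeal) : Prop :=
  (fontainePstAdicCompletion v l hv).IsDeRhamFramed (r.toLocal v) ∧
  (letI := (fontainePstAdicCompletion v l hv).algebra
   (∀ τ : v.adicCompletion F →ₐ[ℚ_[l]] PadicAlgCl l,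
      (let M := r.labelledHodgeTateWeightsAt v
         (fontainePstAdicCompletion v l hv).algebra (fontainePstAdicCompletion v l hv).𝔅 τ.toRingHom
       M.Nodup ∧ Multiset.card M = n)) ∧
   typeClause θ
     (Nonempty (PstCrystallineExtensionData (fontainePstAdicCompletion v l hv)) ∧
       ∀ 𝔈 : PstCrystallineExtensionData (fontainePstAdicCompletion v l hv),
         IsPotentiallyDiagonalizable 𝔈.𝔅 (r.toLocal v))
     (∀ r', (fontainePstAdicCompletion v l hv).IsWeilDeligneOf (r.toLocal v) r' → r'.N = 0))

theorem localCell_mono {θ θ' : ℕ} (hle : θ ≤ θ') {F : Type} [Field F] [NumberField F] {l : ℕ}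
    [Fact l.Prime] {n : ℕ} {r : FramedGaloisRep F (PadicAlgCl l) n} {v : HeightOneSpectrum (𝓞 F)}
    {hv : ((l : ℕ) : 𝓞 F) ∈ v.asIdeal} (h : LocalCell θ F l r v hv) : LocalCell θ' F l r v hv :=
  ⟨h.1, h.2.1, typeClause_mono hle h.2.2⟩

theorem isDeRhamFramed_of_localCell {θ : ℕ} {F : Type} [Field F] [NumberField F] {l : ℕ}
    [Fact l.Prime] {n : ℕ} {r : FramedGaloisRep F (PadicAlgCl l) n} {v : HeightOneSpectrum (𝓞 F)}
    {hv : ((l : ℕ) : 𝓞 F) ∈ v.asIdeal} (h : LocalCell θ F l r v hv) :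
    (fontainePstAdicCompletion v l hv).IsDeRhamFramed (r.toLocal v) :=
  h.1

/-- **Conclusion shape, NORMALISATION-FREE** ("`r|Γ_{F'}` is weakly automorphic over a finite Galois
totally real `F'/F`"): a cuspidal `π` of `GL_n(𝔸_{F'})` and a normalisation exponent `m : ℕ` such that
`π ⊗ |det|^{(1-m)/2}` is L-algebraic (an infinity type `T` of `π` with `T.twist ((1-m)/2)` L-algebraic) and,
at almost every place `w` of `F'`, `r|Γ_{F'}` is unramified with `char r(Frob_w) = ∏_j (X - ι⁻¹((q_w^{(m-1)/2} α_j)⁻¹))`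
for the Satake parameter `α` of `π_w` (`arithFrobPolyOfSatake ι q_w m α`).  With `m = n` and `π` regular
algebraic this is Harris–Lan–Taylor–Thorne's characterising property of `r_{l,ı}(π)` (the fact's
conclusion, Clozel/Caraiani normalisation `rec(π_w ⊗ |det|^{(1-n)/2})`); with `m = 1` and `π` L-algebraic
it is the summit clause `SatakeFrobCompatibleAt` (Buzzard–Gee).  The fact's extra conjunct
"`r|Γ_{F'}` semisimple" is dropped (weaker). [cite: BuzzardGeeLMS2014, §5 and Conj. 3.2.1]
[cite: HarrisLanTaylorThorneRMS2016, Thm. A] -/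
def PotentiallyWeaklyAutomorphicTR (F : Type) [Field F] [NumberField F] (l : ℕ) [Fact l.Prime] {n : ℕ}
    (ι : PadicAlgCl l ≃+* ℂ) (r : FramedGaloisRep F (PadicAlgCl l) n) : Prop :=
  ∃ (F' : Type) (_ : Field F') (_ : NumberField F') (_ : Algebra F F'),
    IsGalois F F' ∧ IsTotallyReal F' ∧
      ∃ (hcpt : isCompact_glFiniteIntegralLevel n F') (π : CuspidalAutomorphicRepData n F' hcpt) (m : ℕ),
        (∃ T : InfinityType F' n, π.1.HasInfinityType T ∧ (T.twist ((1 - (m : ℂ)) / 2)).IsLAlgebraic) ∧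
        ∀ᶠ w : HeightOneSpectrum (𝓞 F') in cofinite, ∃ α : Multiset ℂ,
          π.1.HasSatakeParamAt w α ∧ (r.restrictField F').IsUnramifiedAt w ∧
            (r.restrictField F').HasFrobCharpolyAt w (arithFrobPolyOfSatake ι w.residueCard m α)

/-- **THE FAMILY** `SelfDualPotentialAutomorphy θ` — BLGGT 2014 Thm. C with its binders copied from the
tree's named fact `BLGGT2014_thmC_potentialAutomorphy` (totally real `F`, `0 < n`, prime `l ≥ 2(n+1)`,
`ι`, `r : Γ_F → GL_n(ℚ̄_l)` a.e. unramified, odd essentially self-dual, `r̄|Γ_{F(ζ_l)}` absolutely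
irreducible), ONE binder ADDED (`r` irreducible — implied in print by (4); weaker statement) and the
local clause (3) at `v ∣ l` replaced by the cell `LocalCell θ`:
`θ = 0` potentially diagonalizable (IN THE TREE as the named fact); `θ = 1` potentially crystalline (THE
RUNG, open); `θ ≥ 2` any de Rham = potentially semistable regular type (open).
[cite: BarnetlambEtAl2014, Theorem C (= Cor. 4.5.2, Thm. 4.5.1), §1.4] -/
def SelfDualPotentialAutomorphy (θ : ℕ) : Prop :=
  ∀ (F : Type) [Field F] [NumberField F], IsTotallyReal F →
    ∀ (n : ℕ), 0 < n → ∀ (l : ℕ) [Fact l.Prime], 2 * (n + 1) ≤ l →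
    ∀ (ι : PadicAlgCl l ≃+* ℂ) (r : FramedGaloisRep F (PadicAlgCl l) n),
      r.toGaloisRep.IsIrreducible →
      (∀ᶠ v : HeightOneSpectrum (𝓞 F) in cofinite, r.IsUnramifiedAt v) →
      OddEssSelfDual F l r →
      (∀ (v : HeightOneSpectrum (𝓞 F)) (hv : ((l : ℕ) : 𝓞 F) ∈ v.asIdeal), LocalCell θ F l r v hv) →
      (r.restrictField (CyclotomicField l F)).IsResiduallyAbsIrreducible →
      PotentiallyWeaklyAutomorphicTR F l ι r

/-- **THE RUNG** (the filed statement): the family at `θ = 1` — BLGGT Thm. C for POTENTIALLY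
CRYSTALLINE (not necessarily potentially diagonalizable) regular `r|Γ_{F_v}` at every `v ∣ l`.  OPEN. -/
def PotCrystallinePotentialAutomorphyTR : Prop := SelfDualPotentialAutomorphy 1

theorem rung_iff_family_one : PotCrystallinePotentialAutomorphyTR ↔ SelfDualPotentialAutomorphy 1 :=
  Iff.rfl

/-! ## 3. (F2) Monotonicity -/

theorem mono {θ θ' : ℕ} (hle : θ ≤ θ') (h : SelfDualPotentialAutomorphy θ') :
    SelfDualPotentialAutomorphy θ := by
  intro F _ _ hF n hn l _ hl ι r hirr hunr hsd hloc hres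
  exact h F hF n hn l hl ι r hirr hunr hsd (fun v hv => localCell_mono hle (hloc v hv)) hres

theorem floor_of_rung (h : PotCrystallinePotentialAutomorphyTR) : SelfDualPotentialAutomorphy 0 :=
  mono (by omega) h

/-- The dial is constant from `θ = 2` on (potentially semistable = every de Rham regular type). -/
theorem family_add_two_iff (θ : ℕ) :
    SelfDualPotentialAutomorphy (θ + 2) ↔ SelfDualPotentialAutomorphy 2 := by
  constructor
  · exact fun h => mono (by omega) h
  · intro h F _ _ hF n hn l _ hl ι r hirr hunr hsd hloc hres
    refine h F hF n hn l hl ι r hirr hunr hsd (fun v hv => ?_) hres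
    obtain ⟨h1, h2, -⟩ := hloc v hv
    exact ⟨h1, h2, by simp⟩

/-! ## 4. (F3) Floor: `θ = 0` is the tree's named fact (BLGGT 2014, Theorem C) -/

/-- A C-algebraic infinity type twisted by `|det|^{(1-n)/2}` is L-algebraic
(`a = k + (n-1)/2 ↦ a + (1-n)/2 = k`; Clozel 1990 §3.5, Buzzard–Gee 2014 §5.3). [cite: BuzzardGee2014, §5.3] -/
theorem isLAlgebraic_twist_of_isCAlgebraic {K : Type} [Field K] {n : ℕ} {T : InfinityType K n}
    (hC : T.IsCAlgebraic) : (T.twist ((1 - (n : ℂ)) / 2)).IsLAlgebraic := by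
  simp only [InfinityType.IsLAlgebraic, InfinityType.twist_apply, Multiset.forall_mem_map_iff,
    ArchWeight.twist_a, ArchWeight.twist_b]
  intro σ p hp
  obtain ⟨k, l, hk, hl⟩ := hC σ p hp
  exact ⟨k, l, by rw [hk]; ring, by rw [hl]; ring⟩

/-- **FLOOR** `θ = 0` from the named fact (binders verbatim; `m := n`; the a.e. Satake/charpoly match from
HLTT-compatibility by `eventually_isGaloisCompatibleAt_of_isCompatible` and Flath
`hasSatakeParamAt_cofinite_holds`; L-algebraicity of the `(1-n)/2`-twist of a regular algebraic type). -/
theorem floor_zero (hC : BLGGT2014_thmC_potentialAutomorphy) : SelfDualPotentialAutomorphy 0 := by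
  intro F _ _ hF n hn l _ hl ι r _hirr hunr hsd hloc hres
  obtain ⟨F', i1, i2, i3, hGal, hF', -, hcpt, π, hRA, hcomp⟩ :=
    hC F hF n hn l hl ι r hunr hsd (fun v hv => hloc v hv) hres
  refine ⟨F', i1, i2, i3, hGal, hF', hcpt, π, n, ?_, ?_⟩
  · obtain ⟨T, hT, hCalg, -⟩ := hRA
    exact ⟨T, hT, isLAlgebraic_twist_of_isCAlgebraic hCalg⟩
  · have hae := eventually_isGaloisCompatibleAt_of_isCompatible π (ι := ι) (r := r.restrictField F') hcomp
    have hcof : ∀ᶠ w : HeightOneSpectrum (𝓞 F') in cofinite, ∃ α : Multiset ℂ,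
        π.1.HasSatakeParamAt w α := π.1.hasSatakeParamAt_cofinite_holds
    filter_upwards [hae, hcof] with w h1 ⟨α, hα⟩
    exact ⟨α, hα, (h1 α hα).1, (h1 α hα).2⟩

/-- F3 witness shape: the floor cell by `simpa` from the floor lemma. -/
example (h : BLGGT2014_thmC_potentialAutomorphy) : SelfDualPotentialAutomorphy 0 := by
  simpa using floor_zero h

/-! ## 5. (F4) On-path: the summit, and the top E, give every cell with `F' := F`, `m := 1` -/

/-- Weak automorphy over `F` itself (an L-algebraic cuspidal `π` of `GL_n(𝔸_F)`, Satake–Frobenius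
compatible with `r` at almost all places in the summit's normalisation `m = 1`) is the family's
conclusion with `F' := F` (`Algebra.id`, `IsGalois.self`; restriction along `F ≤ F` is a change of frame,
`ReciprocityTRCM.satakeFrobCompatibleAt_restrictField_self`). [folklore] -/
theorem potentiallyWeaklyAutomorphicTR_self {F : Type} [Field F] [NumberField F] (hF : IsTotallyReal F)
    {l : ℕ} [Fact l.Prime] {n : ℕ} (ι : PadicAlgCl l ≃+* ℂ) (r : FramedGaloisRep F (PadicAlgCl l) n)
    {hcpt : isCompact_glFiniteIntegralLevel n F} (π : CuspidalAutomorphicRepData n F hcpt)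
    (hL : π.1.IsLAlgebraic)
    (hsat : ∀ᶠ v : HeightOneSpectrum (𝓞 F) in cofinite, SatakeFrobCompatibleAt ι π.1 r v) :
    PotentiallyWeaklyAutomorphicTR F l ι r := by
  refine ⟨F, inferInstance, inferInstance, inferInstance, IsGalois.self F, hF, hcpt, π, 1, ?_, ?_⟩
  · obtain ⟨T, hT, hTL⟩ := hL
    refine ⟨T, hT, ?_⟩
    have h0 : (1 - ((1 : ℕ) : ℂ)) / 2 = 0 := by norm_num
    rw [h0, InfinityType.twist_zero]
    exact hTL
  · filter_upwards [hsat] with v hv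
    exact Theorems.ReciprocityTRCM.satakeFrobCompatibleAt_restrictField_self ι π.1 hv

/-- Clause (B) (Galois → automorphic) over totally real `F` for ONE reciprocity datum gives the family's
conclusion for every `r` in any cell (each cell is de Rham for the pinned datum = `Rec.pst` by `rfl`). -/
theorem family_of_galoisToAutomorphic (θ : ℕ)
    (hB : ∀ (F : Type) [Field F] [NumberField F], IsTotallyReal F →
      ∃ Rec : ReciprocityData F, ∀ n : ℕ, 0 < n →
        ∀ hcpt : isCompact_glFiniteIntegralLevel n F, GaloisToAutomorphic n Rec hcpt) :
    SelfDualPotentialAutomorphy θ := by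
  intro F _ _ hF n hn l _ hl ι r hirr hunr _hsd hloc _hres
  obtain ⟨Rec, hall⟩ := hB F hF
  have hgeo : IsGeometricFramed Rec r := ⟨hunr, fun v hv => isDeRhamFramed_of_localCell (hloc v hv)⟩
  obtain ⟨π, hLalg, hcorr⟩ := hall n hn (isCompact_glFiniteIntegralLevel_holds n F) l ι r hirr hgeo
  exact potentiallyWeaklyAutomorphicTR_self hF ι r π hLalg hcorr.1

/-- `Langlands → SelfDualPotentialAutomorphy θ` for every `θ`. -/
theorem family_of_langlands (θ : ℕ) (hL : _root_.Langlands) : SelfDualPotentialAutomorphy θ :=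
  family_of_galoisToAutomorphic θ fun F _ _ _ => by
    obtain ⟨⟨Rec⟩, hall⟩ := hL F
    exact ⟨Rec, fun n hn hcpt => (hall Rec n hn hcpt).2⟩

/-- **F4 ON-PATH LEMMA for the rung**: `Langlands → PotCrystallinePotentialAutomorphyTR`. -/
@[aesop safe apply]
theorem PotCrystallinePotentialAutomorphyTR_of_Langlands (hL : _root_.Langlands) :
    PotCrystallinePotentialAutomorphyTR :=
  family_of_langlands 1 hL

/-- `E → SelfDualPotentialAutomorphy θ` (clause (B) of E for its own `Rec`). -/
theorem family_of_top (θ : ℕ)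
    (hE : Summit.Langlands.Langlands.Theses.OrdinaryPrimeTransport.ReciprocityUpToIrreducibility) :
    SelfDualPotentialAutomorphy θ :=
  family_of_galoisToAutomorphic θ fun F _ _ _ => by
    obtain ⟨Rec, hall⟩ := hE F
    exact ⟨Rec, fun n hn hcpt => (hall n hn hcpt).2⟩

theorem PotCrystallinePotentialAutomorphyTR_of_top
    (hE : Summit.Langlands.Langlands.Theses.OrdinaryPrimeTransport.ReciprocityUpToIrreducibility) :
    PotCrystallinePotentialAutomorphyTR :=
  family_of_top 1 hE

/-! ## 6. The ceiling-lift input, typed (BC9): local potential diagonalizability -/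

/-- **The cap-lifting input of the BLGGT method, typed** (BLGGT 2014 §1.4: "potentially crystalline ⇒
potentially diagonalizable" is expected but unproved beyond the ordinary and Fontaine–Laffaille cases,
Lemma 1.4.3): for every number field `F`, prime `l`, place `v ∣ l` and `r : Γ_F → GL_n(ℚ̄_l)` whose
restriction to `Γ_{F_v}` is de Rham for the pinned datum with every attached Weil–Deligne representation
having `N = 0`, that restriction is potentially diagonalizable for every instance of compatible
crystalline extension data (and an instance exists).  NOT a stub of the line — a named open input with the
PROVED reduction `rung_of_localPD`. [cite: BarnetlambEtAl2014, §1.4 and Lemma 1.4.3] -/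
def LocalPotentialDiagonalizability : Prop :=
  ∀ (F : Type) [Field F] [NumberField F] (l : ℕ) [Fact l.Prime] (n : ℕ)
    (r : FramedGaloisRep F (PadicAlgCl l) n) (v : HeightOneSpectrum (𝓞 F)) (hv : ((l : ℕ) : 𝓞 F) ∈ v.asIdeal),
    letI := (fontainePstAdicCompletion v l hv).algebra
    (fontainePstAdicCompletion v l hv).IsDeRhamFramed (r.toLocal v) →
    (∀ r', (fontainePstAdicCompletion v l hv).IsWeilDeligneOf (r.toLocal v) r' → r'.N = 0) →
    Nonempty (PstCrystallineExtensionData (fontainePstAdicCompletion v l hv)) ∧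
      ∀ 𝔈 : PstCrystallineExtensionData (fontainePstAdicCompletion v l hv),
        IsPotentiallyDiagonalizable 𝔈.𝔅 (r.toLocal v)

/-- **The lift closes the rung over the floor**: local potential diagonalizability + BLGGT Thm. C ⇒ the
rung (bookkeeping: cell 1 ⊆ cell 0 under the lift). -/
theorem rung_of_localPD (hPD : LocalPotentialDiagonalizability) (hC : BLGGT2014_thmC_potentialAutomorphy) :
    PotCrystallinePotentialAutomorphyTR := by
  intro F _ _ hF n hn l _ hl ι r hirr hunr hsd hloc hres
  refine floor_zero hC F hF n hn l hl ι r hirr hunr hsd (fun v hv => ?_) hres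
  obtain ⟨h1, h2, h3⟩ := hloc v hv
  refine ⟨h1, h2, ?_⟩
  rcases h3 with h3 | h3
  · exact h3
  · exact hPD F l n r v hv h1 h3

/-! ## 7. The sector, its merge target and the off-sector complement -/

/-- **The potentially semistable odd self-dual regular sector of clause (B)**: `F` totally real,
`l ≥ 2(n+1)`, `r` odd essentially self-dual, in cell `θ = 2` at every `v ∣ l` (de Rham with `n` distinct
labelled Hodge–Tate numbers) and `r̄|Γ_{F(ζ_l)}` absolutely irreducible. -/
def InSelfDualRegularSector (F : Type) [Field F] [NumberField F] (l : ℕ) [Fact l.Prime] {n : ℕ}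
    (r : FramedGaloisRep F (PadicAlgCl l) n) : Prop :=
  IsTotallyReal F ∧ 2 * (n + 1) ≤ l ∧ OddEssSelfDual F l r ∧
    (∀ (v : HeightOneSpectrum (𝓞 F)) (hv : ((l : ℕ) : 𝓞 F) ∈ v.asIdeal), LocalCell 2 F l r v hv) ∧
    (r.restrictField (CyclotomicField l F)).IsResiduallyAbsIrreducible

/-- **Merge target**: clause (B) of E VERBATIM (cuspidal, L-algebraic, `Corresponds Rec ι π r`) for EVERY
reciprocity datum `Rec`, on the sector. -/
def SectorGaloisToAutomorphic : Prop :=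
  ∀ (F : Type) [Field F] [NumberField F] (Rec : ReciprocityData F) (n : ℕ), 0 < n →
    ∀ (hcpt : isCompact_glFiniteIntegralLevel n F) (l : ℕ) [Fact l.Prime] (ι : PadicAlgCl l ≃+* ℂ)
      (r : FramedGaloisRep F (PadicAlgCl l) n),
      r.toGaloisRep.IsIrreducible → IsGeometricFramed Rec r → InSelfDualRegularSector F l r →
        ∃ π : CuspidalAutomorphicRepData n F hcpt, π.1.IsLAlgebraic ∧ Corresponds Rec ι π.1 r

/-- **Sector-merge step** (gap node): from POTENTIAL weak automorphy on the whole sector (the family at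
`θ = 2`) to clause (B) of E verbatim on the sector, for every `Rec` — descent of automorphy along the Galois
totally real `F'/F` (soluble: base change; NON-soluble: open), cuspidality/L-algebraicity over `F`, and
local–global compatibility at every finite place against the pinned data. -/
def SectorMergeStep : Prop :=
  SelfDualPotentialAutomorphy 2 → SectorGaloisToAutomorphic

/-- **The cells above the rung** (gap node): the family on the `r` in cell 2 but NOT in cell 1 at some
`v ∣ l` (genuinely potentially semistable types, `N ≠ 0`). -/
def HigherRungs : Prop :=
  ∀ (F : Type) [Field F] [NumberField F], IsTotallyReal F →
    ∀ (n : ℕ), 0 < n → ∀ (l : ℕ) [Fact l.Prime], 2 * (n + 1) ≤ l →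
    ∀ (ι : PadicAlgCl l ≃+* ℂ) (r : FramedGaloisRep F (PadicAlgCl l) n),
      r.toGaloisRep.IsIrreducible →
      (∀ᶠ v : HeightOneSpectrum (𝓞 F) in cofinite, r.IsUnramifiedAt v) →
      OddEssSelfDual F l r →
      (∀ (v : HeightOneSpectrum (𝓞 F)) (hv : ((l : ℕ) : 𝓞 F) ∈ v.asIdeal), LocalCell 2 F l r v hv) →
      ¬ (∀ (v : HeightOneSpectrum (𝓞 F)) (hv : ((l : ℕ) : 𝓞 F) ∈ v.asIdeal), LocalCell 1 F l r v hv) →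
      (r.restrictField (CyclotomicField l F)).IsResiduallyAbsIrreducible →
      PotentiallyWeaklyAutomorphicTR F l ι r

/-- Rung + the cells above it = the family on the whole sector `θ = 2` (sorry-free glue). [folklore] -/
theorem family_two_of (hr : PotCrystallinePotentialAutomorphyTR) (hh : HigherRungs) :
    SelfDualPotentialAutomorphy 2 := by
  intro F _ _ hF n hn l _ hl ι r hirr hunr hsd hloc hres
  by_cases h1 : ∀ (v : HeightOneSpectrum (𝓞 F)) (hv : ((l : ℕ) : 𝓞 F) ∈ v.asIdeal), LocalCell 1 F l r v hv
  · exact hr F hF n hn l hl ι r hirr hunr hsd h1 hres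
  · exact hh F hF n hn l hl ι r hirr hunr hsd hloc h1 hres

/-- **The off-sector complement**: E with clause (A) entire and clause (B) restricted to `r` NOT in the
sector (non-totally-real `F`, small `l`, no odd essential self-duality, irregular or non-de-Rham type,
residually reducible over `F(ζ_l)`). -/
def OffSectorReciprocity : Prop :=
  ∀ (F : Type) [Field F] [NumberField F], ∃ Rec : ReciprocityData F, ∀ n : ℕ, 0 < n →
    ∀ hcpt : isCompact_glFiniteIntegralLevel n F,
      (∀ π : CuspidalAutomorphicRepData n F hcpt, π.1.IsLAlgebraic →
        ∀ (ℓ : ℕ) [Fact ℓ.Prime] (ι : PadicAlgCl ℓ ≃+* ℂ),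
          ∃ ρ : FramedGaloisRep F (PadicAlgCl ℓ) n, IsGeometricFramed Rec ρ ∧ Corresponds Rec ι π.1 ρ) ∧
      (∀ (ℓ : ℕ) [Fact ℓ.Prime] (ι : PadicAlgCl ℓ ≃+* ℂ) (ρ : FramedGaloisRep F (PadicAlgCl ℓ) n),
        ρ.toGaloisRep.IsIrreducible → IsGeometricFramed Rec ρ → ¬ InSelfDualRegularSector F ℓ ρ →
          ∃ π : CuspidalAutomorphicRepData n F hcpt, π.1.IsLAlgebraic ∧ Corresponds Rec ι π.1 ρ)

/-! ## 8. The four registered stubs (one per obligation node) -/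

/-- **THE RUNG** (open): BLGGT Thm. C beyond potential diagonalizability — potentially crystalline regular
odd essentially self-dual `r` over totally real `F` with `r̄|Γ_{F(ζ_l)}` irreducible, `l ≥ 2(n+1)`, is
potentially automorphic.  Located stop: BLGGT Thm. 4.3.1 / 4.5.1 connect `r` to a potentially automorphic
`r₀` only inside a common irreducible component of the crystalline deformation ring met by a sum of
crystalline characters (`r ∼ r₀`, §1.4); the lift is `LocalPotentialDiagonalizability` (`rung_of_localPD`). -/
theorem stub_rung : PotCrystallinePotentialAutomorphyTR := by
  sorry

/-- **The higher rungs** (potentially semistable regular types with non-zero monodromy at some `v ∣ l`). -/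
theorem stub_higherRungs : HigherRungs := by
  sorry

/-- Sector merge: from potential weak automorphy on the sector to clause (B) of E verbatim on the sector,
for every `Rec` (descent along `F'/F`, soluble and non-soluble; strong multiplicity one; local–global
compatibility at every finite place against the pinned data). -/
theorem stub_sectorMerge : SectorMergeStep := by
  sorry

/-- The honest complement: E off the sector. -/
theorem stub_offSector : OffSectorReciprocity := by
  sorry

/-! ## 9. Composition (no sorry below this line) -/

/-- **THE SKELETON THEOREM** — the item's decl BY NAME (the `OrdinaryPrimeTransport` copy of the decl,
`Iff.rfl`-equal to the primary `IrreducibilityBySelfDuality` decl), whose only `sorry`s are the four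
registered stubs. -/
theorem ReciprocityUpToIrreducibility_proof :
    Summit.Langlands.Langlands.Theses.OrdinaryPrimeTransport.ReciprocityUpToIrreducibility := by
  intro F _ _
  obtain ⟨Rec, hall⟩ := stub_offSector F
  refine ⟨Rec, fun n hn hcpt => ⟨(hall n hn hcpt).1, ?_⟩⟩
  intro ℓ _ ι ρ hirr hgeo
  by_cases hsec : InSelfDualRegularSector F ℓ ρ
  · exact stub_sectorMerge (family_two_of stub_rung stub_higherRungs) F Rec n hn hcpt ℓ ι ρ hirr hgeo hsec
  · exact (hall n hn hcpt).2 ℓ ι ρ hirr hgeo hsec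

/-- The ladder's top, a REDUCIBLE alias of the crux decl. -/
abbrev TopCrux : Prop :=
  Summit.Langlands.Langlands.Theses.OrdinaryPrimeTransport.ReciprocityUpToIrreducibility

example : TopCrux ↔ Summit.Langlands.Langlands.Theses.OrdinaryPrimeTransport.ReciprocityUpToIrreducibility :=
  Iff.rfl

/-- **COMPOSITION IN HYPOTHESIS FORM** — the crux from the four stub STATEMENTS, no `sorry` anywhere in this
theorem or its dependencies: `Rung θ₁ → Gap → Merge → OffSector → C`. -/
theorem ReciprocityUpToIrreducibility_of :
    PotCrystallinePotentialAutomorphyTR → HigherRungs → SectorMergeStep → OffSectorReciprocity → TopCrux := by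
  intro hr hh hmerge hoff F _ _
  obtain ⟨Rec, hall⟩ := hoff F
  refine ⟨Rec, fun n hn hcpt => ⟨(hall n hn hcpt).1, ?_⟩⟩
  intro ℓ _ ι ρ hirr hgeo
  by_cases hsec : InSelfDualRegularSector F ℓ ρ
  · exact hmerge (family_two_of hr hh) F Rec n hn hcpt ℓ ι ρ hirr hgeo hsec
  · exact (hall n hn hcpt).2 ℓ ι ρ hirr hgeo hsec

#print axioms ReciprocityUpToIrreducibility_of
#print axioms floor_zero
#print axioms PotCrystallinePotentialAutomorphyTR_of_Langlands

end Summit.Langlands.Langlands.Cruxes.ReciprocityUpToIrreducibility.PotCrystallinePotentialAutomorphyTR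

end
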